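import Mathlib
import HarnessLib
import Literature.NumberTheory.LFunctions.HorocycleRateHalfStrip
import Literature.NumberTheory.LFunctions.HorocycleRateHalfArcBound
import Literature.NumberTheory.LFunctions.HorocyclePhase
import Literature.Analysis.FunctionSpaces.SmoothParametricIntegral

/-!
# The `w`-derivative of the Fourier coefficients of the arc transform

Support file (everything PROVED, no named facts) for the proof of the named fact
`Literature.NumberTheory.LFunctions.horocycleRate_of_quasiRH` (`HorocycleRH.lean`; Zagier 1981,
§1 p. 279, (Z1): quasi-RH with abscissa `2 - 2θ` gives the rate `O(y^{θ-ε})` for closed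
horocycles on `SL(2,ℤ)\ℍ`).

After unfolding and Fourier analysis on the arcs (`HorocycleUnfolding`, `HorocyclePhase`), the
horocycle average of a smooth `Γ`-invariant cusp-supported `F` is
`2y ∑_c ∑_k c_c(k) b_k(c²y)` with the Ramanujan sums `c_c(k)` and the coefficients
`b_k(w) = ∫_ℝ e(k X_w(t)) ĝ_k(Y_w(t)) dt`, `X_w(t) = -t/(w(1+t²))`, `Y_w(t) = 1/(w(1+t²))`,
`ĝ_k(h) = ∫₀¹ g(θ+ih) e(-kθ) dθ` (`HorocyclePhase.coeff_integral_apply_hpt`). The Möbius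
cancellation in `c` (partial summation against `M(x) = O(x^{Θ+ε})`) needs the coefficients to be
`C¹` in the dilation parameter `w` with `‖b_k'(w)‖ ≪ |k|⁻³ w⁻¹`. This file proves exactly that:

* `arcCoeff g k w` is `b_k(w)` in the form of `coeff_integral_apply_hpt` (`arcCoeff_eq_coeff`);
* differentiation under the integral sign in `w` (`hasDerivAt_arcCoeff_raw`: `b_k(w) = B(1/w)`
  with `B(r) = ∫ e(k r X_1(t)) ĝ_k(r Y_1(t)) dt`, a parametric integral of a smooth integrand on
  `ℝ²`, differentiated by `Literature.Analysis.FunctionSpaces.hasFDerivAt_parametric_intervalIntegral`);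
* the identity `X_w' = Y_w - 2w Y_w²`, whence `d/dt [Q e(kX_w)] = P e(kX_w)` for
  `Q = -2πik t ĝ_k(Y_w) - ĝ_k'(Y_w)` and an explicit `P` (`hasDerivAt_Q_mul_e`), and one
  integration by parts: `b_k'(w) = -b_k(w)/w + ∫ t Y_w² (4πik ĝ_k(Y_w) + ĝ_k''(Y_w)/(πik)) e(kX_w) dt`
  (`hasDerivAt_arcCoeff`);
* the bound `‖b_k'(w)‖ ≤ C(1+|k|)/w` (`exists_norm_arcCoeffDeriv_le`, via `norm_integral_rho_le`
  and the tree's uniform bound `‖b_k(w)‖ ≤ M/|k|³`) and, through `ĝ_k = (2πik)⁻⁴ (∂θ⁴ g)^_k`, the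
  decay form `‖b_k'(w)‖ ≤ C/(|k|³ w)` (`exists_bound_hasDerivAt_arcCoeff`, the export used by the
  Möbius partial summation in `HorocycleRHQuasiRHProofs.lean`).

## References
* D. Zagier, *Eisenstein series and the Riemann zeta function*, in: Automorphic forms,
  representation theory and arithmetic (Bombay 1979), Springer 1981, 275–301, §1 [Zagier1981].
* H. Iwaniec, *Spectral Methods of Automorphic Forms*, 2nd ed., AMS GSM 53 (2002), §3.4
  [Iwaniec2002].

## Mathlib / tree search
Mathlib: `intervalIntegral.integral_eq_sub_of_hasDerivAt`, `HasDerivAt.comp`, `hasDerivAt_inv`.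
Tree: `HorocyclePhase.hasDerivAt_X`, `hasDerivAt_Y`, `coeff_integral_apply_hpt`,
`exists_norm_coeffPsi_le`; `IsStripFun.hasDerivAt_sliceFourierCoeff`, `sliceFourierCoeff_eq_derivTheta`
(`HorocycleRateHalfStrip.lean`); `Literature.Analysis.FunctionSpaces.fderiv_parametric_intervalIntegral_apply`.
-/

noncomputable section

open Real Complex MeasureTheory Set Filter intervalIntegral
open scoped Topology ContDiff

namespace Literature.NumberTheory.LFunctions

namespace HorocycleArcCoeffDeriv

open HorocyclePhase HorocycleStripFourier

variable {Y₁ : ℝ} {g : ℂ → ℂ}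

/-! ### The horocycle coordinates `Y_w(t) = 1/(w(1+t²))`, `X_w(t) = -t/(w(1+t²))` -/

/-- The height `Y_w(t) = 1/(w(1+t²))` of the horocycle point. [folklore] -/
def Yf (w t : ℝ) : ℝ := 1 / (w * (1 + t ^ 2))

/-- The abscissa `X_w(t) = -t/(w(1+t²))` of the horocycle point (relative to the cusp). [folklore] -/
def Xf (w t : ℝ) : ℝ := -t / (w * (1 + t ^ 2))

/-- The phase factor `e(k X_w(t))`. [folklore] -/
def ef (k : ℤ) (w t : ℝ) : ℂ := Complex.exp (2 * π * I * k * (Xf w t : ℂ))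

/-- `1 + t² > 0`. [folklore] -/
private theorem one_add_sq_pos (t : ℝ) : 0 < 1 + t ^ 2 := by positivity

/-- `X = -t Y`. [folklore] -/
theorem Xf_eq (w t : ℝ) : Xf w t = -t * Yf w t := by
  unfold Xf Yf; ring

/-- `Y_w > 0` for `w > 0`. [folklore] -/
theorem Yf_pos {w : ℝ} (hw : 0 < w) (t : ℝ) : 0 < Yf w t := by
  unfold Yf; positivity

/-- `w Y (1+t²) = 1`. [folklore] -/
theorem w_mul_Yf_mul {w : ℝ} (hw : w ≠ 0) (t : ℝ) : w * Yf w t * (1 + t ^ 2) = 1 := by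
  unfold Yf
  have := one_add_sq_pos t
  field_simp

/-- Dilation: `Y_w(t) = (1/w) Y_1(t)`. [folklore] -/
theorem Yf_eq_div (w t : ℝ) : Yf w t = (1 / w) * Yf 1 t := by
  unfold Yf
  rw [one_mul]
  rcases eq_or_ne w 0 with hw | hw
  · simp [hw]
  · have := one_add_sq_pos t
    field_simp

/-- Dilation: `X_w(t) = (1/w) X_1(t)`. [folklore] -/
theorem Xf_eq_div (w t : ℝ) : Xf w t = (1 / w) * Xf 1 t := by
  rw [Xf_eq, Xf_eq, Yf_eq_div w t]; ring

/-- `Y ≤ 1/w` for `w > 0`. [folklore] -/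
theorem Yf_le {w : ℝ} (hw : 0 < w) (t : ℝ) : Yf w t ≤ 1 / w := by
  unfold Yf
  rw [div_le_div_iff₀ (by positivity) hw]
  nlinarith [sq_nonneg t]

/-- The phase factor has norm one. [folklore] -/
theorem norm_ef (k : ℤ) (w t : ℝ) : ‖ef k w t‖ = 1 := by
  unfold ef
  have e : (2 * π * I * k * (Xf w t : ℂ)) = ((2 * π * k * Xf w t : ℝ) : ℂ) * I := by
    push_cast; ring
  rw [e, Complex.norm_exp_ofReal_mul_I]

/-- The tree's phase `2πik(-t/(w(1+t²)))` (division in `ℂ`) is `2πik X_w(t)`. [folklore] -/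
theorem phase_cast (k : ℤ) (w t : ℝ) :
    (2 * π * I * k * (-(t : ℂ) / ((w : ℂ) * (1 + (t : ℂ) ^ 2)))) = 2 * π * I * k * (Xf w t : ℂ) := by
  unfold Xf; push_cast; ring

/-- The tree's height `1/(w(1+t²))` is `Y_w(t)`. [folklore] -/
theorem height_eq (w t : ℝ) : 1 / (w * (1 + t ^ 2)) = Yf w t := rfl

/-! ### Derivatives of the coordinates in `t` -/

/-- `Y' = -2tw Y²`. [folklore] -/
theorem hasDerivAt_Yf {w : ℝ} (hw : w ≠ 0) (t : ℝ) :
    HasDerivAt (fun t => Yf w t) (-2 * t * w * Yf w t ^ 2) t := by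
  have h := hasDerivAt_Y hw t
  refine h.congr_deriv ?_
  unfold Yf
  have := one_add_sq_pos t
  field_simp

/-- `X' = Y - 2w Y²` (the key identity behind the integration by parts). [folklore] -/
theorem hasDerivAt_Xf {w : ℝ} (hw : w ≠ 0) (t : ℝ) :
    HasDerivAt (fun t => Xf w t) (Yf w t - 2 * w * Yf w t ^ 2) t := by
  have h := hasDerivAt_X hw t
  refine h.congr_deriv ?_
  unfold Yf
  have := one_add_sq_pos t
  field_simp
  ring

/-- `d/dt e(kX_w(t)) = 2πik (Y - 2wY²) e(kX_w(t))`. [folklore] -/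
theorem hasDerivAt_ef (k : ℤ) {w : ℝ} (hw : w ≠ 0) (t : ℝ) :
    HasDerivAt (fun t => ef k w t)
      (ef k w t * (2 * π * I * k * ((Yf w t - 2 * w * Yf w t ^ 2 : ℝ) : ℂ))) t := by
  unfold ef
  have h1 : HasDerivAt (fun t : ℝ => 2 * π * I * k * (Xf w t : ℂ))
      (2 * π * I * k * ((Yf w t - 2 * w * Yf w t ^ 2 : ℝ) : ℂ)) t :=
    ((hasDerivAt_Xf hw t).ofReal_comp).const_mul _
  exact h1.cexp

/-- `t² Y² = Y/w - Y²`. [folklore] -/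
theorem sq_mul_Yf_sq {w : ℝ} (hw : w ≠ 0) (t : ℝ) : t ^ 2 * Yf w t ^ 2 = Yf w t / w - Yf w t ^ 2 := by
  unfold Yf
  have := one_add_sq_pos t
  field_simp
  ring

/-! ### The coefficient `b_k(w)` -/

/-- **The Fourier coefficient of the arc transform**,
`b_k(w) = ∫_ℝ e(k X_w(t)) ĝ_k(Y_w(t)) dt` (the right-hand side of
`HorocyclePhase.coeff_integral_apply_hpt`, with `ĝ_k = sliceFourierCoeff g k`). [folklore] -/
def arcCoeff (g : ℂ → ℂ) (k : ℤ) (w : ℝ) : ℂ :=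
  ∫ t : ℝ, ef k w t * sliceFourierCoeff g k (Yf w t)

/-- **Bridge**: for `w > 0`, `arcCoeff g k w = ∫₀¹ Ψ(w,θ) e(-kθ) dθ`, the `k`-th Fourier
coefficient of the horocycle integral `Ψ(w,θ) = ∫ g(θ - 1/(w(t+i))) dt`
(`HorocyclePhase.coeff_integral_apply_hpt`). [folklore] -/
theorem arcCoeff_eq_coeff (hg : IsStripFun Y₁ g) {w : ℝ} (hw : 0 < w) (k : ℤ) :
    arcCoeff g k w = ∫ θ in (0:ℝ)..1, (∫ t : ℝ, g ((θ : ℂ) - 1 / ((w : ℂ) * ((t : ℂ) + I)))) *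
        Complex.exp (-(2 * π * I * k * θ)) := by
  rw [coeff_integral_apply_hpt hg.contDiff.continuous hg.periodic hg.supp' (by norm_num) hw k]
  unfold arcCoeff ef sliceFourierCoeff
  refine integral_congr_ae (ae_of_all _ fun t => ?_)
  beta_reduce
  rw [phase_cast]
  rfl

/-- Support of `ĝ_k ∘ Y_w`: if `ĝ_k(Y_w(t)) ≠ 0` (for any strip function, e.g. a derivative of
`g`) then `|t| < √(2/w)`. [folklore] -/
theorem abs_lt_of_ne_zero {f : ℂ → ℂ} (hf : IsStripFun Y₁ f) {w : ℝ} (hw : 0 < w) (k : ℤ) {t : ℝ}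
    (h : sliceFourierCoeff f k (Yf w t) ≠ 0) : |t| < Real.sqrt (2 / w) := by
  have hGs : ∀ h, sliceFourierCoeff f k h ≠ 0 → 1 / 2 < h ∧ h < max Y₁ (1 / 2) := fun h hh =>
    coeff_support hf.contDiff.continuous hf.supp' k h hh
  have := abs_lt_sqrt_of_apply_Y_ne_zero (a := 1 / 2) (b := max Y₁ (1 / 2)) (by norm_num) hw hGs
    (t := t) h
  convert this using 2
  field_simp

/-- On the support, `Y_w(t) < max Y₁ (1/2)`. [folklore] -/
theorem Yf_lt_of_ne_zero {f : ℂ → ℂ} (hf : IsStripFun Y₁ f) (w : ℝ) (k : ℤ) {t : ℝ}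
    (h : sliceFourierCoeff f k (Yf w t) ≠ 0) : 1 / 2 < Yf w t ∧ Yf w t < max Y₁ (1 / 2) :=
  coeff_support hf.contDiff.continuous hf.supp' k _ h

/-- Off `|t| < √(2/w)` the factor `ĝ_k(Y_w(t))` vanishes. [folklore] -/
theorem coeff_Yf_eq_zero {f : ℂ → ℂ} (hf : IsStripFun Y₁ f) {w : ℝ} (hw : 0 < w) (k : ℤ) {t : ℝ}
    (ht : Real.sqrt (2 / w) ≤ |t|) : sliceFourierCoeff f k (Yf w t) = 0 := by
  by_contra h
  exact absurd (abs_lt_of_ne_zero hf hw k h) (not_lt.mpr ht)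

/-- For `w ≥ 2` all heights are `≤ 1/2`: `b_k(w) = 0`. [folklore] -/
theorem arcCoeff_eq_zero_of_two_le (hg : IsStripFun Y₁ g) (k : ℤ) {w : ℝ} (hw : 2 ≤ w) :
    arcCoeff g k w = 0 := by
  unfold arcCoeff
  have h0 : ∀ t : ℝ, sliceFourierCoeff g k (Yf w t) = 0 := fun t => by
    apply hg.sliceFourierCoeff_eq_zero_of_le
    have hw0 : 0 < w := by linarith
    calc Yf w t ≤ 1 / w := Yf_le hw0 t
      _ ≤ 1 / 2 := by rw [div_le_div_iff₀ hw0 two_pos]; linarith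
  simp [h0]

/-- **Uniform bound** `‖b_k(w)‖ ≤ M/|k|³` (`w > 0`, `k ≠ 0`), from
`HorocyclePhase.exists_norm_coeffPsi_le`. [folklore] -/
theorem exists_norm_arcCoeff_le (hg : IsStripFun Y₁ g) :
    ∃ M : ℝ, 0 ≤ M ∧ ∀ w : ℝ, 0 < w → ∀ k : ℤ, k ≠ 0 → ‖arcCoeff g k w‖ ≤ M / |(k : ℝ)| ^ 3 := by
  obtain ⟨M, hM0, hM⟩ := exists_norm_coeffPsi_le hg.contDiff hg.periodic hg.supp' (a := 1 / 2)
    (b := max Y₁ (1 / 2)) (by norm_num) (le_max_right _ _)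
  refine ⟨M, hM0, fun w hw k hk => ?_⟩
  rw [arcCoeff_eq_coeff hg hw k]
  exact hM w hw k hk

/-! ### Differentiation under the integral sign in `w` -/

/-- The smooth two-variable integrand `H(t, r) = e(k r X_1(t)) ĝ_k(r Y_1(t))`; at `r = 1/w` it
is the integrand of `b_k(w)`. [folklore] -/
def Hf (g : ℂ → ℂ) (k : ℤ) (p : ℝ × ℝ) : ℂ :=
  Complex.exp (2 * π * I * k * ((p.2 * Xf 1 p.1 : ℝ) : ℂ)) * sliceFourierCoeff g k (p.2 * Yf 1 p.1)

/-- `t ↦ X_1(t)` is smooth. [folklore] -/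
theorem contDiff_Xf_one : ContDiff ℝ ∞ (fun t : ℝ => Xf 1 t) := by
  unfold Xf
  refine ContDiff.div contDiff_neg (contDiff_const.mul (contDiff_const.add (contDiff_id.pow 2)))
    fun t => ?_
  have := one_add_sq_pos t
  positivity

/-- `t ↦ Y_1(t)` is smooth. [folklore] -/
theorem contDiff_Yf_one : ContDiff ℝ ∞ (fun t : ℝ => Yf 1 t) := by
  unfold Yf
  refine ContDiff.div contDiff_const (contDiff_const.mul (contDiff_const.add (contDiff_id.pow 2)))
    fun t => ?_
  have := one_add_sq_pos t
  positivity

/-- `H` is smooth on `ℝ²`. [folklore] -/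
theorem contDiff_Hf (hg : IsStripFun Y₁ g) (k : ℤ) : ContDiff ℝ ∞ (Hf g k) := by
  unfold Hf
  have h1 : ContDiff ℝ ∞ fun p : ℝ × ℝ => p.2 * Xf 1 p.1 :=
    contDiff_snd.mul (contDiff_Xf_one.comp contDiff_fst)
  have h2 : ContDiff ℝ ∞ fun p : ℝ × ℝ => p.2 * Yf 1 p.1 :=
    contDiff_snd.mul (contDiff_Yf_one.comp contDiff_fst)
  have h3 : ContDiff ℝ ∞ fun p : ℝ × ℝ => 2 * π * I * k * ((p.2 * Xf 1 p.1 : ℝ) : ℂ) :=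
    contDiff_const.mul (Complex.ofRealCLM.contDiff.comp h1)
  exact (Complex.contDiff_exp.comp h3).mul ((hg.contDiff_sliceFourierCoeff k).comp h2)

/-- The partial derivative of `H` in `r`. [folklore] -/
def Hr (g : ℂ → ℂ) (k : ℤ) (t r : ℝ) : ℂ :=
  Complex.exp (2 * π * I * k * ((r * Xf 1 t : ℝ) : ℂ)) *
    ((2 * π * I * k * (Xf 1 t : ℂ)) * sliceFourierCoeff g k (r * Yf 1 t) +
      (Yf 1 t : ℂ) * sliceFourierCoeff (derivH g) k (r * Yf 1 t))

/-- `∂_r H(t, r) = Hr(t, r)`. [folklore] -/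
theorem hasDerivAt_Hf (hg : IsStripFun Y₁ g) (k : ℤ) (t r : ℝ) :
    HasDerivAt (fun r => Hf g k (t, r)) (Hr g k t r) r := by
  show HasDerivAt (fun r => Complex.exp (2 * π * I * k * ((r * Xf 1 t : ℝ) : ℂ)) *
    sliceFourierCoeff g k (r * Yf 1 t)) (Hr g k t r) r
  have hE : HasDerivAt (fun r : ℝ => Complex.exp (2 * π * I * k * ((r * Xf 1 t : ℝ) : ℂ)))
      (Complex.exp (2 * π * I * k * ((r * Xf 1 t : ℝ) : ℂ)) * (2 * π * I * k * (Xf 1 t : ℂ))) r := by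
    have h1 : HasDerivAt (fun r : ℝ => ((r * Xf 1 t : ℝ) : ℂ)) ((Xf 1 t : ℝ) : ℂ) r :=
      (hasDerivAt_mul_const (Xf 1 t)).ofReal_comp
    exact (h1.const_mul (2 * π * I * k)).cexp
  have hG : HasDerivAt (fun r : ℝ => sliceFourierCoeff g k (r * Yf 1 t))
      ((Yf 1 t : ℂ) * sliceFourierCoeff (derivH g) k (r * Yf 1 t)) r := by
    have h1 := (hg.hasDerivAt_sliceFourierCoeff k (r * Yf 1 t)).scomp r (hasDerivAt_mul_const (Yf 1 t))
    simp only [Function.comp_def, Complex.real_smul] at h1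
    exact h1
  refine (hE.mul hG).congr_deriv ?_
  simp only [Hr]
  ring

/-- The value of `fderiv H` on the parameter direction `(0, 1)` is `Hr`. [folklore] -/
theorem fderiv_Hf_apply (hg : IsStripFun Y₁ g) (k : ℤ) (t r : ℝ) :
    fderiv ℝ (Hf g k) (t, r) ((0 : ℝ), (1 : ℝ)) = Hr g k t r := by
  have hn : (∞ : WithTop ℕ∞) ≠ 0 := by simp
  have h1 := (Literature.Analysis.FunctionSpaces.hasFDerivAt_comp_prodMk (contDiff_Hf hg k) hn t r).hasDerivAt
  have h2 := hasDerivAt_Hf hg k t r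
  have h3 := h1.unique h2
  simpa [ContinuousLinearMap.comp_apply, ContinuousLinearMap.inr_apply] using h3

/-- The parametric integral `B(r) = ∫_{-T}^{T} H(t, r) dt` has derivative `∫_{-T}^{T} Hr(t, r) dt`.
[folklore] -/
theorem hasDerivAt_B (hg : IsStripFun Y₁ g) (k : ℤ) (T r : ℝ) :
    HasDerivAt (fun r : ℝ => ∫ t in (-T)..T, Hf g k (t, r)) (∫ t in (-T)..T, Hr g k t r) r := by
  have hn : (∞ : WithTop ℕ∞) ≠ 0 := by simp
  have hd := ((Literature.Analysis.FunctionSpaces.differentiable_parametric_intervalIntegral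
    (contDiff_Hf hg k) hn (-T) T) r).hasDerivAt
  rw [← fderiv_apply_one_eq_deriv,
    Literature.Analysis.FunctionSpaces.fderiv_parametric_intervalIntegral_apply (contDiff_Hf hg k) hn] at hd
  refine hd.congr_deriv (intervalIntegral.integral_congr fun t _ => ?_)
  exact fderiv_Hf_apply hg k t r

/-- `H(t, 1/w)` is the integrand of `b_k(w)`. [folklore] -/
theorem Hf_one_div (g : ℂ → ℂ) (k : ℤ) (w t : ℝ) :
    Hf g k (t, 1 / w) = ef k w t * sliceFourierCoeff g k (Yf w t) := by
  unfold Hf ef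
  rw [← Xf_eq_div, ← Yf_eq_div]

/-- `b_k(w)` as an integral over `[-T, T]` for any `T ≥ √(2/w)`. [folklore] -/
theorem arcCoeff_eq_intervalIntegral (hg : IsStripFun Y₁ g) (k : ℤ) {w : ℝ} (hw : 0 < w) {T : ℝ}
    (hT : Real.sqrt (2 / w) ≤ T) :
    arcCoeff g k w = ∫ t in (-T)..T, ef k w t * sliceFourierCoeff g k (Yf w t) := by
  unfold arcCoeff
  symm
  apply intervalIntegral.integral_eq_integral_of_support_subset
  intro t ht
  rw [Function.mem_support] at ht
  have hG : sliceFourierCoeff g k (Yf w t) ≠ 0 := fun h => ht (by rw [h, mul_zero])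
  have := abs_lt_of_ne_zero hg hw k hG
  rw [abs_lt] at this
  exact ⟨by linarith, by linarith⟩

/-- A general compactly supported integrand along the horocycle, as an interval integral: if
`φ(t) = 0` for `|t| ≥ √(2/w)` then `∫_ℝ φ = ∫_{-T}^{T} φ` for `T ≥ √(2/w)`. [folklore] -/
theorem integral_eq_intervalIntegral_of_vanish {φ : ℝ → ℂ} {w T : ℝ}
    (hφ : ∀ t, Real.sqrt (2 / w) ≤ |t| → φ t = 0) (hT : Real.sqrt (2 / w) ≤ T) :
    ∫ t : ℝ, φ t = ∫ t in (-T)..T, φ t := by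
  symm
  apply intervalIntegral.integral_eq_integral_of_support_subset
  intro t ht
  rw [Function.mem_support] at ht
  have : |t| < Real.sqrt (2 / w) := by
    by_contra h
    exact ht (hφ t (not_lt.mp h))
  rw [abs_lt] at this
  exact ⟨by linarith, by linarith⟩

/-- **Differentiation under the integral sign (raw form).** For `w > 0`,
`b_k'(w) = -(1/w) ∫ (2πik X_w ĝ_k(Y_w) + Y_w ĝ_k'(Y_w)) e(kX_w) dt`. [folklore] -/
theorem hasDerivAt_arcCoeff_raw (hg : IsStripFun Y₁ g) (k : ℤ) {w : ℝ} (hw : 0 < w) :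
    HasDerivAt (arcCoeff g k)
      (-(1 / w) * ∫ t : ℝ, (2 * π * I * k * (Xf w t : ℂ) * sliceFourierCoeff g k (Yf w t) +
        (Yf w t : ℂ) * sliceFourierCoeff (derivH g) k (Yf w t)) * ef k w t) w := by
  -- the interval of integration, valid for all `w' > w/2`
  set T : ℝ := Real.sqrt (4 / w) with hT
  have hTw : ∀ w' : ℝ, w / 2 < w' → Real.sqrt (2 / w') ≤ T := fun w' hw' => by
    apply Real.sqrt_le_sqrt
    have hw'0 : 0 < w' := by linarith
    rw [div_le_div_iff₀ hw'0 hw]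
    linarith
  -- `b_k = B ∘ (1/·)` near `w`
  set B : ℝ → ℂ := fun r => ∫ t in (-T)..T, Hf g k (t, r) with hB
  have heq : (arcCoeff g k) =ᶠ[𝓝 w] fun w' => B (1 / w') := by
    filter_upwards [Ioi_mem_nhds (show w / 2 < w by linarith)] with w' hw'
    have hw'0 : 0 < w' := by linarith [mem_Ioi.mp hw']
    rw [arcCoeff_eq_intervalIntegral hg k hw'0 (hTw w' hw'), hB]
    simp only [Hf_one_div]
  have hBd := hasDerivAt_B hg k T (1 / w)
  have hinv : HasDerivAt (fun w' : ℝ => 1 / w') (-(1 / w ^ 2)) w := by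
    simpa [one_div] using hasDerivAt_inv hw.ne'
  have hcomp := hBd.scomp w hinv
  refine (hcomp.congr_of_eventuallyEq heq).congr_deriv ?_
  -- identify the derivative
  have hvan : ∀ t, Real.sqrt (2 / w) ≤ |t| →
      (2 * π * I * k * (Xf w t : ℂ) * sliceFourierCoeff g k (Yf w t) +
        (Yf w t : ℂ) * sliceFourierCoeff (derivH g) k (Yf w t)) * ef k w t = 0 := fun t ht => by
    rw [coeff_Yf_eq_zero hg hw k ht, coeff_Yf_eq_zero hg.dH hw k ht]; ring
  rw [integral_eq_intervalIntegral_of_vanish hvan (hTw w (by linarith)), Complex.real_smul,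
    ← intervalIntegral.integral_const_mul, ← intervalIntegral.integral_const_mul]
  refine intervalIntegral.integral_congr fun t _ => ?_
  simp only [Hr]
  rw [← Xf_eq_div, ← Yf_eq_div, Xf_eq_div w t, Yf_eq_div w t]
  unfold ef
  rw [Xf_eq_div w t]
  have hw0 : (w : ℂ) ≠ 0 := by exact_mod_cast hw.ne'
  push_cast
  field_simp

/-! ### One integration by parts along the horocycle -/

/-- `ĝ_k(Y_w(t))`. [folklore] -/
def G0 (g : ℂ → ℂ) (k : ℤ) (w t : ℝ) : ℂ := sliceFourierCoeff g k (Yf w t)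

/-- `ĝ_k'(Y_w(t)) = (∂h g)^_k(Y_w(t))`. [folklore] -/
def G1 (g : ℂ → ℂ) (k : ℤ) (w t : ℝ) : ℂ := sliceFourierCoeff (derivH g) k (Yf w t)

/-- `ĝ_k''(Y_w(t)) = (∂h² g)^_k(Y_w(t))`. [folklore] -/
def G2 (g : ℂ → ℂ) (k : ℤ) (w t : ℝ) : ℂ := sliceFourierCoeff (derivH (derivH g)) k (Yf w t)

/-- `Y_w` is continuous in `t` (`w ≠ 0`). [folklore] -/
theorem continuous_Yf {w : ℝ} (hw : w ≠ 0) : Continuous fun t : ℝ => Yf w t := by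
  unfold Yf
  exact continuous_const.div (by fun_prop) fun t => mul_ne_zero hw (one_add_sq_pos t).ne'

/-- `X_w` is continuous in `t` (`w ≠ 0`). [folklore] -/
theorem continuous_Xf {w : ℝ} (hw : w ≠ 0) : Continuous fun t : ℝ => Xf w t := by
  unfold Xf
  exact (continuous_neg).div (by fun_prop) fun t => mul_ne_zero hw (one_add_sq_pos t).ne'

/-- The phase factor is continuous in `t` (`w ≠ 0`). [folklore] -/
theorem continuous_ef (k : ℤ) {w : ℝ} (hw : w ≠ 0) : Continuous fun t : ℝ => ef k w t := by
  unfold ef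
  exact Complex.continuous_exp.comp (continuous_const.mul
    (Complex.continuous_ofReal.comp (continuous_Xf hw)))

/-- `ĝ_k ∘ Y_w` is continuous for a strip function (or its derivatives). [folklore] -/
theorem continuous_coeff_Yf {f : ℂ → ℂ} (hf : IsStripFun Y₁ f) (k : ℤ) {w : ℝ} (hw : w ≠ 0) :
    Continuous fun t : ℝ => sliceFourierCoeff f k (Yf w t) :=
  (hf.continuous_sliceFourierCoeff k).comp (continuous_Yf hw)

/-- A continuous function vanishing for `|t| ≥ R` is integrable. [folklore] -/
theorem integrable_of_vanish {φ : ℝ → ℂ} (hc : Continuous φ) {R : ℝ}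
    (hφ : ∀ t, R ≤ |t| → φ t = 0) : Integrable φ := by
  refine hc.integrable_of_hasCompactSupport ?_
  refine HasCompactSupport.intro (isCompact_Icc (a := -|R|) (b := |R|)) fun t ht => hφ t ?_
  rw [Set.mem_Icc, not_and_or, not_le, not_le] at ht
  have hR : R ≤ |R| := le_abs_self R
  have hR0 : 0 ≤ |R| := abs_nonneg R
  rcases ht with ht | ht
  · have : |R| < |t| := by rw [abs_of_neg (show t < 0 by linarith)]; linarith
    linarith
  · have : |R| < |t| := lt_of_lt_of_le ht (le_abs_self t)
    linarith

/-- `d/dt ĝ_k(Y_w(t)) = -2twY² ĝ_k'(Y_w(t))`. [folklore] -/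
theorem hasDerivAt_G0 (hg : IsStripFun Y₁ g) (k : ℤ) {w : ℝ} (hw : w ≠ 0) (t : ℝ) :
    HasDerivAt (fun t => G0 g k w t) (((-2 * t * w * Yf w t ^ 2 : ℝ) : ℂ) * G1 g k w t) t := by
  have h1 := (hg.hasDerivAt_sliceFourierCoeff k (Yf w t)).scomp t (hasDerivAt_Yf hw t)
  simp only [Function.comp_def, Complex.real_smul] at h1
  exact h1

/-- `d/dt ĝ_k'(Y_w(t)) = -2twY² ĝ_k''(Y_w(t))`. [folklore] -/
theorem hasDerivAt_G1 (hg : IsStripFun Y₁ g) (k : ℤ) {w : ℝ} (hw : w ≠ 0) (t : ℝ) :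
    HasDerivAt (fun t => G1 g k w t) (((-2 * t * w * Yf w t ^ 2 : ℝ) : ℂ) * G2 g k w t) t := by
  have h1 := (hg.dH.hasDerivAt_sliceFourierCoeff k (Yf w t)).scomp t (hasDerivAt_Yf hw t)
  simp only [Function.comp_def, Complex.real_smul] at h1
  exact h1

/-- The primitive `Q = -2πik t ĝ_k(Y) - ĝ_k'(Y)` of the integration by parts. [folklore] -/
def Qt (g : ℂ → ℂ) (k : ℤ) (w t : ℝ) : ℂ :=
  -(2 * π * I * k) * ((t : ℂ) * G0 g k w t) - G1 g k w t

/-- The derivative `P` with `d/dt [Q e(kX)] = P e(kX)`: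
`P = 2πik Y (-2πik t ĝ_k + ĝ_k') - 2πik ĝ_k + 2w t Y² ĝ_k'' + 2 (2πik)² w t Y² ĝ_k`. [folklore] -/
def Pt (g : ℂ → ℂ) (k : ℤ) (w t : ℝ) : ℂ :=
  (2 * π * I * k) * ((Yf w t : ℂ) * (-(2 * π * I * k) * (t : ℂ) * G0 g k w t + G1 g k w t)) -
    (2 * π * I * k) * G0 g k w t + 2 * (w : ℂ) * (t : ℂ) * (Yf w t : ℂ) ^ 2 * G2 g k w t +
    2 * (2 * π * I * k) ^ 2 * (w : ℂ) * (t : ℂ) * (Yf w t : ℂ) ^ 2 * G0 g k w t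

/-- **The exact derivative** `d/dt [Q(t) e(kX_w(t))] = P(t) e(kX_w(t))`; the content is
`X_w' = Y_w - 2wY_w²` and `wY_w(1+t²) = 1`. [folklore] -/
theorem hasDerivAt_Q_mul_e (hg : IsStripFun Y₁ g) (k : ℤ) {w : ℝ} (hw : w ≠ 0) (t : ℝ) :
    HasDerivAt (fun t => Qt g k w t * ef k w t) (Pt g k w t * ef k w t) t := by
  have hG0 := hasDerivAt_G0 hg k hw t
  have hG1 := hasDerivAt_G1 hg k hw t
  have he := hasDerivAt_ef k hw t
  have ht : HasDerivAt (fun t : ℝ => (t : ℂ)) 1 t := by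
    simpa using (hasDerivAt_id t).ofReal_comp
  have hQ : HasDerivAt (fun t => Qt g k w t)
      (-(2 * π * I * k) * (1 * G0 g k w t + (t : ℂ) * (((-2 * t * w * Yf w t ^ 2 : ℝ) : ℂ) * G1 g k w t)) -
        ((-2 * t * w * Yf w t ^ 2 : ℝ) : ℂ) * G2 g k w t) t := by
    unfold Qt
    exact ((ht.mul hG0).const_mul _).sub hG1
  refine (hQ.mul he).congr_deriv ?_
  have hY1 : ((w * Yf w t * (1 + t ^ 2) : ℝ) : ℂ) = 1 := by
    rw [w_mul_Yf_mul hw t]; simp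
  unfold Pt Qt
  push_cast at hY1 ⊢
  linear_combination (ef k w t * (2 * (2 * π * I * k) * G1 g k w t * (Yf w t : ℂ))) * hY1

/-- `Q(t) = 0` for `|t| ≥ √(2/w)`. [folklore] -/
theorem Qt_eq_zero (hg : IsStripFun Y₁ g) (k : ℤ) {w : ℝ} (hw : 0 < w) {t : ℝ}
    (ht : Real.sqrt (2 / w) ≤ |t|) : Qt g k w t = 0 := by
  unfold Qt G0 G1
  rw [coeff_Yf_eq_zero hg hw k ht, coeff_Yf_eq_zero hg.dH hw k ht]
  simp

/-- `P(t) = 0` for `|t| ≥ √(2/w)`. [folklore] -/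
theorem Pt_eq_zero (hg : IsStripFun Y₁ g) (k : ℤ) {w : ℝ} (hw : 0 < w) {t : ℝ}
    (ht : Real.sqrt (2 / w) ≤ |t|) : Pt g k w t = 0 := by
  unfold Pt G0 G1 G2
  rw [coeff_Yf_eq_zero hg hw k ht, coeff_Yf_eq_zero hg.dH hw k ht,
    coeff_Yf_eq_zero hg.dH.dH hw k ht]
  simp

/-- `t ↦ P(t) e(kX_w(t))` is continuous. [folklore] -/
theorem continuous_Pt_mul_e (hg : IsStripFun Y₁ g) (k : ℤ) {w : ℝ} (hw : w ≠ 0) :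
    Continuous fun t => Pt g k w t * ef k w t := by
  unfold Pt G0 G1 G2
  have h0 : Continuous (sliceFourierCoeff g k) := hg.continuous_sliceFourierCoeff k
  have h1 : Continuous (sliceFourierCoeff (derivH g) k) := hg.dH.continuous_sliceFourierCoeff k
  have h2 : Continuous (sliceFourierCoeff (derivH (derivH g)) k) :=
    hg.dH.dH.continuous_sliceFourierCoeff k
  have hY : Continuous fun t : ℝ => Yf w t := continuous_Yf hw
  have he : Continuous fun t : ℝ => ef k w t := continuous_ef k hw
  fun_prop

/-- **The integration by parts**: `∫_ℝ P(t) e(kX_w(t)) dt = 0` (`Q e(kX)` has compact support).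
[folklore] -/
theorem integral_Pt_mul_e (hg : IsStripFun Y₁ g) (k : ℤ) {w : ℝ} (hw : 0 < w) :
    ∫ t : ℝ, Pt g k w t * ef k w t = 0 := by
  set T : ℝ := Real.sqrt (2 / w) + 1 with hT
  have hT0 : 0 < T := by positivity
  have hTle : Real.sqrt (2 / w) ≤ T := by rw [hT]; linarith
  have hvan : ∀ t, Real.sqrt (2 / w) ≤ |t| → Pt g k w t * ef k w t = 0 := fun t ht => by
    rw [Pt_eq_zero hg k hw ht, zero_mul]
  rw [integral_eq_intervalIntegral_of_vanish hvan hTle,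
    intervalIntegral.integral_eq_sub_of_hasDerivAt (f := fun t => Qt g k w t * ef k w t)
      (fun t _ => hasDerivAt_Q_mul_e hg k hw.ne' t)
      ((continuous_Pt_mul_e hg k hw.ne').intervalIntegrable _ _)]
  have h1 : Qt g k w T = 0 := Qt_eq_zero hg k hw (by rw [abs_of_pos hT0]; linarith)
  have h2 : Qt g k w (-T) = 0 := Qt_eq_zero hg k hw (by rw [abs_neg, abs_of_pos hT0]; linarith)
  simp [h1, h2]

/-! ### The formula for `b_k'(w)` -/

/-- The remainder integrand `ρ(t) = t Y² (2(2πik) ĝ_k(Y) + (2/(2πik)) ĝ_k''(Y)) e(kX)`. [folklore] -/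
def rho (g : ℂ → ℂ) (k : ℤ) (w t : ℝ) : ℂ :=
  (t : ℂ) * (Yf w t : ℂ) ^ 2 *
    (2 * (2 * π * I * k) * G0 g k w t + 2 / (2 * π * I * k) * G2 g k w t) * ef k w t

/-- **The derivative** `b_k'(w) = -b_k(w)/w + ∫ ρ`. [folklore] -/
def arcCoeffDeriv (g : ℂ → ℂ) (k : ℤ) (w : ℝ) : ℂ :=
  -arcCoeff g k w / w + ∫ t : ℝ, rho g k w t

/-- `ρ(t) = 0` for `|t| ≥ √(2/w)`. [folklore] -/
theorem rho_eq_zero (hg : IsStripFun Y₁ g) (k : ℤ) {w : ℝ} (hw : 0 < w) {t : ℝ}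
    (ht : Real.sqrt (2 / w) ≤ |t|) : rho g k w t = 0 := by
  unfold rho G0 G2
  rw [coeff_Yf_eq_zero hg hw k ht, coeff_Yf_eq_zero hg.dH.dH hw k ht]
  simp

/-- `ρ` is continuous. [folklore] -/
theorem continuous_rho (hg : IsStripFun Y₁ g) (k : ℤ) {w : ℝ} (hw : w ≠ 0) :
    Continuous fun t => rho g k w t := by
  unfold rho G0 G2
  have h0 : Continuous (sliceFourierCoeff g k) := hg.continuous_sliceFourierCoeff k
  have h2 : Continuous (sliceFourierCoeff (derivH (derivH g)) k) :=
    hg.dH.dH.continuous_sliceFourierCoeff k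
  have hY : Continuous fun t : ℝ => Yf w t := continuous_Yf hw
  have he : Continuous fun t : ℝ => ef k w t := continuous_ef k hw
  fun_prop

/-- `2πik ≠ 0` for `k ≠ 0`. [folklore] -/
theorem two_pi_I_k_ne_zero {k : ℤ} (hk : k ≠ 0) : (2 * π * I * k : ℂ) ≠ 0 := by
  have hπ : (π : ℂ) ≠ 0 := by exact_mod_cast Real.pi_ne_zero
  have hk' : (k : ℂ) ≠ 0 := by exact_mod_cast hk
  simp [hπ, hk', I_ne_zero]

/-- **`b_k` is `C¹` on `(0, ∞)` with `b_k'(w) = -b_k(w)/w + ∫ t Y² (4πik ĝ_k + ĝ_k''/(πik)) e dt.**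
[folklore] -/
theorem hasDerivAt_arcCoeff (hg : IsStripFun Y₁ g) {k : ℤ} (hk : k ≠ 0) {w : ℝ} (hw : 0 < w) :
    HasDerivAt (arcCoeff g k) (arcCoeffDeriv g k w) w := by
  refine (hasDerivAt_arcCoeff_raw hg k hw).congr_deriv ?_
  have hw' : w ≠ 0 := hw.ne'
  have h2πk := two_pi_I_k_ne_zero hk
  -- the three integrands
  set sf : ℝ → ℂ := fun t => (2 * π * I * k * (Xf w t : ℂ) * sliceFourierCoeff g k (Yf w t) +
    (Yf w t : ℂ) * sliceFourierCoeff (derivH g) k (Yf w t)) * ef k w t with hsf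
  set bf : ℝ → ℂ := fun t => ef k w t * sliceFourierCoeff g k (Yf w t) with hbf
  have hPt : ∀ t, Pt g k w t * ef k w t =
      (2 * π * I * k) * (sf t - bf t + (w : ℂ) * rho g k w t) := fun t => by
    have hX : (Xf w t : ℂ) = -(t : ℂ) * (Yf w t : ℂ) := by rw [Xf_eq]; push_cast; ring
    simp only [hsf, hbf, rho, Pt, G0, G1, G2, hX]
    field_simp
    ring
  -- integrability
  have hsi : Integrable sf := by
    refine integrable_of_vanish ?_ (R := Real.sqrt (2 / w)) fun t ht => ?_
    · have h0 : Continuous (sliceFourierCoeff g k) := hg.continuous_sliceFourierCoeff k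
      have h1 : Continuous (sliceFourierCoeff (derivH g) k) := hg.dH.continuous_sliceFourierCoeff k
      have hY : Continuous fun t : ℝ => Yf w t := continuous_Yf hw'
      have hXc : Continuous fun t : ℝ => Xf w t := continuous_Xf hw'
      have he : Continuous fun t : ℝ => ef k w t := continuous_ef k hw'
      simp only [hsf]
      fun_prop
    · simp only [hsf]
      rw [coeff_Yf_eq_zero hg hw k ht, coeff_Yf_eq_zero hg.dH hw k ht]; ring
  have hbi : Integrable bf := by
    refine integrable_of_vanish ?_ (R := Real.sqrt (2 / w)) fun t ht => ?_
    · have h0 : Continuous (sliceFourierCoeff g k) := hg.continuous_sliceFourierCoeff k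
      have hY : Continuous fun t : ℝ => Yf w t := continuous_Yf hw'
      have he : Continuous fun t : ℝ => ef k w t := continuous_ef k hw'
      simp only [hbf]
      fun_prop
    · simp only [hbf]
      rw [coeff_Yf_eq_zero hg hw k ht, mul_zero]
  have hρi : Integrable fun t => rho g k w t :=
    integrable_of_vanish (continuous_rho hg k hw') fun t ht => rho_eq_zero hg k hw ht
  -- the integration by parts, rearranged
  have h0 := integral_Pt_mul_e hg k hw
  have hI : ∫ t : ℝ, Pt g k w t * ef k w t =
      (2 * π * I * k) * ((∫ t, sf t) - (∫ t, bf t) + (w : ℂ) * ∫ t, rho g k w t) := by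
    have e1 : ∫ t, Pt g k w t * ef k w t = ∫ t, (2 * π * I * k) * (sf t - bf t + (w : ℂ) * rho g k w t) :=
      integral_congr_ae (ae_of_all _ hPt)
    have e2 : ∫ t, (sf t - bf t + (w : ℂ) * rho g k w t) =
        (∫ t, sf t - bf t) + ∫ t, (w : ℂ) * rho g k w t :=
      integral_add (hsi.sub hbi) (hρi.const_mul _)
    have e3 : ∫ t, (sf t - bf t) = (∫ t, sf t) - ∫ t, bf t := integral_sub hsi hbi
    have e4 : ∫ t, (w : ℂ) * rho g k w t = (w : ℂ) * ∫ t, rho g k w t :=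
      MeasureTheory.integral_const_mul _ _
    rw [e1, MeasureTheory.integral_const_mul, e2, e3, e4]
  rw [hI] at h0
  have key : (∫ t, sf t) = (∫ t, bf t) - (w : ℂ) * ∫ t, rho g k w t := by
    have := (mul_eq_zero.mp h0).resolve_left h2πk
    linear_combination this
  have hb : arcCoeff g k w = ∫ t, bf t := rfl
  unfold arcCoeffDeriv
  rw [key, hb]
  have hwC : (w : ℂ) ≠ 0 := by exact_mod_cast hw'
  field_simp
  ring

/-! ### Bounds -/

/-- `‖2πik‖ = 2π|k|`. [folklore] -/
theorem norm_two_pi_I_k (k : ℤ) : ‖(2 * π * I * k : ℂ)‖ = 2 * π * |(k : ℝ)| := by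
  simp [abs_of_pos Real.pi_pos]

/-- **Bound for the remainder**: `‖∫ ρ‖ ≤ (4/w) b² (4π|k| S₀ + S₂/(π|k|))`, `b = max Y₁ (1/2)`,
where `S₀ ≥ ‖ĝ_k‖∞`, `S₂ ≥ ‖ĝ_k''‖∞`. [folklore] -/
theorem norm_integral_rho_le (hg : IsStripFun Y₁ g) {k : ℤ} (hk : k ≠ 0) {w : ℝ} (hw : 0 < w)
    {S₀ S₂ : ℝ} (hS₀ : ∀ h, ‖sliceFourierCoeff g k h‖ ≤ S₀)
    (hS₂ : ∀ h, ‖sliceFourierCoeff (derivH (derivH g)) k h‖ ≤ S₂) :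
    ‖∫ t : ℝ, rho g k w t‖ ≤
      (4 / w) * (max Y₁ (1 / 2)) ^ 2 * (4 * π * |(k : ℝ)| * S₀ + S₂ / (π * |(k : ℝ)|)) := by
  set T : ℝ := Real.sqrt (2 / w) with hT
  set bb : ℝ := max Y₁ (1 / 2) with hbb
  set L : ℝ := 4 * π * |(k : ℝ)| * S₀ + S₂ / (π * |(k : ℝ)|) with hL
  have hT0 : 0 ≤ T := Real.sqrt_nonneg _
  have hT2 : T ^ 2 = 2 / w := Real.sq_sqrt (by positivity)
  have hk0 : (0 : ℝ) < |(k : ℝ)| := abs_pos.mpr (Int.cast_ne_zero.mpr hk)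
  have hS₀0 : 0 ≤ S₀ := (norm_nonneg _).trans (hS₀ 0)
  have hS₂0 : 0 ≤ S₂ := (norm_nonneg _).trans (hS₂ 0)
  have hL0 : 0 ≤ L := by positivity
  have hbb0 : 0 < bb := lt_max_of_lt_right (by norm_num)
  -- pointwise bound
  have hpt : ∀ t, ‖rho g k w t‖ ≤ |t| * bb ^ 2 * L := by
    intro t
    by_cases hz : sliceFourierCoeff g k (Yf w t) = 0 ∧ sliceFourierCoeff (derivH (derivH g)) k (Yf w t) = 0
    · have : rho g k w t = 0 := by unfold rho G0 G2; rw [hz.1, hz.2]; simp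
      rw [this, norm_zero]; positivity
    · have hY : Yf w t < bb := by
        rcases not_and_or.mp hz with h | h
        · exact (Yf_lt_of_ne_zero hg w k h).2
        · exact (Yf_lt_of_ne_zero hg.dH.dH w k h).2
      have hY0 : 0 < Yf w t := Yf_pos hw t
      have hYsq : (Yf w t) ^ 2 ≤ bb ^ 2 := by gcongr
      have hmid : ‖2 * (2 * π * I * k) * G0 g k w t + 2 / (2 * π * I * k) * G2 g k w t‖ ≤ L := by
        refine (norm_add_le _ _).trans ?_
        have n1 : ‖2 * (2 * π * I * k) * G0 g k w t‖ = 2 * (2 * π * |(k:ℝ)|) * ‖G0 g k w t‖ := by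
          rw [norm_mul, norm_mul, norm_two_pi_I_k, Complex.norm_ofNat]
        have n2 : ‖2 / (2 * π * I * k) * G2 g k w t‖ = 2 / (2 * π * |(k:ℝ)|) * ‖G2 g k w t‖ := by
          rw [norm_mul, norm_div, norm_two_pi_I_k, Complex.norm_ofNat]
        rw [n1, n2, hL]
        unfold G0 G2
        have e1 : 2 * (2 * π * |(k:ℝ)|) * ‖sliceFourierCoeff g k (Yf w t)‖ ≤ 4 * π * |(k:ℝ)| * S₀ := by
          have := mul_le_mul_of_nonneg_left (hS₀ (Yf w t)) (by positivity : (0:ℝ) ≤ 4 * π * |(k:ℝ)|)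
          linarith
        have e2 : 2 / (2 * π * |(k:ℝ)|) * ‖sliceFourierCoeff (derivH (derivH g)) k (Yf w t)‖ ≤
            S₂ / (π * |(k:ℝ)|) := by
          rw [show 2 / (2 * π * |(k:ℝ)|) = 1 / (π * |(k:ℝ)|) by field_simp, one_div_mul_eq_div]
          exact div_le_div_of_nonneg_right (hS₂ _) (by positivity)
        linarith
      unfold rho
      rw [norm_mul, norm_mul, norm_mul, norm_ef, mul_one, Complex.norm_real, Real.norm_eq_abs,
        norm_pow, Complex.norm_real, Real.norm_eq_abs, abs_of_pos hY0]
      gcongr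
  -- integrate over `[-T, T]`
  have hvan : ∀ t, Real.sqrt (2 / w) ≤ |t| → rho g k w t = 0 := fun t ht => rho_eq_zero hg k hw ht
  rw [integral_eq_intervalIntegral_of_vanish hvan le_rfl]
  have hle := intervalIntegral.norm_integral_le_of_norm_le_const (a := -T) (b := T)
    (C := T * bb ^ 2 * L) (f := fun t => rho g k w t) (fun t ht => by
      refine (hpt t).trans ?_
      have : |t| ≤ T := by
        rw [Set.uIoc_of_le (by linarith), Set.mem_Ioc] at ht
        exact abs_le.mpr ⟨ht.1.le, ht.2⟩
      gcongr)
  refine hle.trans ?_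
  rw [show T - -T = 2 * T by ring, abs_of_nonneg (by positivity)]
  calc T * bb ^ 2 * L * (2 * T) = 2 * T ^ 2 * bb ^ 2 * L := by ring
    _ = (4 / w) * bb ^ 2 * L := by rw [hT2]; ring
    _ ≤ _ := le_rfl

/-- **`‖b_k'(w)‖ ≤ C (1 + |k|)/w`** uniformly in `k ≠ 0`, `w > 0`. [folklore] -/
theorem exists_norm_arcCoeffDeriv_le (hg : IsStripFun Y₁ g) :
    ∃ C : ℝ, 0 ≤ C ∧ ∀ k : ℤ, k ≠ 0 → ∀ w : ℝ, 0 < w →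
      ‖arcCoeffDeriv g k w‖ ≤ C * (1 + |(k : ℝ)|) / w := by
  obtain ⟨M, hM0, hM⟩ := exists_norm_arcCoeff_le hg
  obtain ⟨B₀, hB₀0, hB₀⟩ := hg.exists_bound
  obtain ⟨B₂, hB₂0, hB₂⟩ := hg.dH.dH.exists_bound
  set bb : ℝ := max Y₁ (1 / 2) with hbb
  refine ⟨M + 16 * π * bb ^ 2 * B₀ + 4 * bb ^ 2 * B₂, by positivity, fun k hk w hw => ?_⟩
  have hk1 : (1 : ℝ) ≤ |(k : ℝ)| := by
    rw [← Int.cast_abs]; exact_mod_cast Int.one_le_abs hk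
  have hk0 : (0 : ℝ) < |(k : ℝ)| := by linarith
  have h1 : ‖-arcCoeff g k w / w‖ ≤ M / w := by
    rw [norm_div, norm_neg, Complex.norm_real, Real.norm_of_nonneg hw.le]
    refine div_le_div_of_nonneg_right ((hM w hw k hk).trans ?_) hw.le
    rw [div_le_iff₀ (by positivity)]
    calc M = M * 1 := by ring
      _ ≤ M * |(k:ℝ)| ^ 3 := by gcongr; exact one_le_pow₀ hk1
  have h2 := norm_integral_rho_le hg hk hw (fun h => norm_sliceFourierCoeff_le hB₀ k h)
    (fun h => norm_sliceFourierCoeff_le hB₂ k h)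
  have h3 : (4 / w) * bb ^ 2 * (4 * π * |(k : ℝ)| * B₀ + B₂ / (π * |(k : ℝ)|)) ≤
      (16 * π * bb ^ 2 * B₀ * |(k:ℝ)| + 4 * bb ^ 2 * B₂) / w := by
    rw [div_mul_eq_mul_div, div_mul_eq_mul_div, div_le_div_iff_of_pos_right hw]
    have : B₂ / (π * |(k : ℝ)|) ≤ B₂ := by
      rw [div_le_iff₀ (by positivity)]
      calc B₂ = B₂ * 1 := by ring
        _ ≤ B₂ * (π * |(k:ℝ)|) := by gcongr; nlinarith [Real.pi_gt_three]
    nlinarith [sq_nonneg bb, Real.pi_pos]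
  unfold arcCoeffDeriv
  refine (norm_add_le _ _).trans ?_
  refine (add_le_add h1 (h2.trans h3)).trans ?_
  rw [← add_div, div_le_div_iff_of_pos_right hw]
  have : 0 ≤ bb ^ 2 := sq_nonneg bb
  nlinarith [mul_nonneg hM0 hk0.le, mul_nonneg (mul_nonneg this hB₀0) Real.pi_pos.le,
    mul_nonneg (mul_nonneg this hB₂0) hk0.le]

/-! ### Decay in `k` through `θ`-derivatives -/

/-- Four integrations by parts in `θ`: `ĝ_k = (2πik)⁻⁴ (∂θ⁴ g)^_k`. [folklore] -/
theorem sliceFourierCoeff_eq_derivTheta_four (hg : IsStripFun Y₁ g) {k : ℤ} (hk : k ≠ 0) (h : ℝ) :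
    sliceFourierCoeff g k h = (1 / (2 * π * I * k)) ^ 4 *
      sliceFourierCoeff (derivTheta (derivTheta (derivTheta (derivTheta g)))) k h := by
  rw [hg.sliceFourierCoeff_eq_derivTheta hk, hg.dTheta.sliceFourierCoeff_eq_derivTheta hk,
    hg.dTheta.dTheta.sliceFourierCoeff_eq_derivTheta hk,
    hg.dTheta.dTheta.dTheta.sliceFourierCoeff_eq_derivTheta hk]
  ring

/-- Hence `b_k[g] = (2πik)⁻⁴ b_k[∂θ⁴ g]` (all `w`). [folklore] -/
theorem arcCoeff_eq_derivTheta_four (hg : IsStripFun Y₁ g) {k : ℤ} (hk : k ≠ 0) (w : ℝ) :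
    arcCoeff g k w = (1 / (2 * π * I * k)) ^ 4 *
      arcCoeff (derivTheta (derivTheta (derivTheta (derivTheta g)))) k w := by
  unfold arcCoeff
  rw [← MeasureTheory.integral_const_mul]
  refine integral_congr_ae (ae_of_all _ fun t => ?_)
  beta_reduce
  rw [sliceFourierCoeff_eq_derivTheta_four hg hk]
  ring

/-- **Main export.** For a strip test function `g` there is `C` with: for all `k ≠ 0` and `w > 0`,
`b_k = arcCoeff g k` is differentiable at `w` with `‖b_k'(w)‖ ≤ C / (|k|³ w)`. [folklore] -/
theorem exists_bound_hasDerivAt_arcCoeff (hg : IsStripFun Y₁ g) :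
    ∃ C : ℝ, 0 ≤ C ∧ ∀ k : ℤ, k ≠ 0 → ∀ w : ℝ, 0 < w →
      ∃ D : ℂ, HasDerivAt (arcCoeff g k) D w ∧ ‖D‖ ≤ C / (|(k : ℝ)| ^ 3 * w) := by
  set g₄ : ℂ → ℂ := derivTheta (derivTheta (derivTheta (derivTheta g))) with hg₄
  have hg₄s : IsStripFun Y₁ g₄ := hg.dTheta.dTheta.dTheta.dTheta
  obtain ⟨C₄, hC₄0, hC₄⟩ := exists_norm_arcCoeffDeriv_le hg₄s
  refine ⟨2 * C₄, by positivity, fun k hk w hw => ?_⟩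
  set c : ℂ := (1 / (2 * π * I * k)) ^ 4 with hc
  refine ⟨c * arcCoeffDeriv g₄ k w, ?_, ?_⟩
  · have hfun : arcCoeff g k = fun w => c * arcCoeff g₄ k w :=
      funext fun w => arcCoeff_eq_derivTheta_four hg hk w
    rw [hfun]
    exact (hasDerivAt_arcCoeff hg₄s hk hw).const_mul c
  · have hk1 : (1 : ℝ) ≤ |(k : ℝ)| := by
      rw [← Int.cast_abs]; exact_mod_cast Int.one_le_abs hk
    have hk0 : (0 : ℝ) < |(k : ℝ)| := by linarith
    have hnc : ‖c‖ = 1 / (2 * π * |(k : ℝ)|) ^ 4 := by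
      rw [hc, norm_pow, norm_div, norm_one, norm_two_pi_I_k, div_pow, one_pow]
    rw [norm_mul, hnc]
    refine (mul_le_mul_of_nonneg_left (hC₄ k hk w hw) (by positivity)).trans ?_
    rw [div_mul_div_comm, one_mul, div_le_div_iff₀ (by positivity) (by positivity)]
    -- `C₄ (1+|k|) |k|³ w ≤ 2 C₄ (2π|k|)⁴ w`
    have h2π : (1 : ℝ) ≤ 2 * π := by linarith [Real.pi_gt_three]
    have hk4 : |(k:ℝ)| ^ 4 ≤ (2 * π * |(k : ℝ)|) ^ 4 := by
      rw [mul_pow]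
      calc |(k:ℝ)| ^ 4 = 1 * |(k:ℝ)| ^ 4 := by ring
        _ ≤ (2 * π) ^ 4 * |(k:ℝ)| ^ 4 := by gcongr; exact one_le_pow₀ h2π
    calc C₄ * (1 + |(k:ℝ)|) * (|(k:ℝ)| ^ 3 * w) ≤ C₄ * (2 * |(k:ℝ)|) * (|(k:ℝ)| ^ 3 * w) := by
          gcongr; linarith
      _ = 2 * C₄ * (|(k:ℝ)| ^ 4 * w) := by ring
      _ ≤ 2 * C₄ * ((2 * π * |(k : ℝ)|) ^ 4 * w) := by gcongr

end HorocycleArcCoeffDeriv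

end Literature.NumberTheory.LFunctions

end
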